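import Summits.AtomisticToContinuum.HydrodynamicLimit.Theorems.CollisionIsometryCLTCollisionalTransferLocalityDefs
import Literature.Analysis.FunctionSpaces.TorusCalculusProofs
import Literature.Analysis.FluidPDE.FractionalNSPrescribedEnergyIterationLimit
import HarnessLib

/-!
# Regularity of the time derivative of smooth space–time tests on `[0, t] × 𝕋³`

Helper file (`--supports stmt-AtomisticToContinuum-9518`, line `hemisphere-affine-slaving`, skeleton
v10.1) for the crux `CollisionalTransferLocality`: the two registered stubs of the equilibrium rung on
the one-sided time derivative `∂ₜu = Torus.timeDerivWithin (Icc 0 t) u` of a test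
`u : ℝ → 𝕋³ → F` that is jointly smooth on `[0, t] × 𝕋³` (`Torus.IsSmoothSpaceTimeOn (Icc 0 t) u`,
i.e. the space–time lift `(s, y) ↦ u s (proj y)` is `C^∞` on `[0, t] × ℝ³`), `0 < t`:

* `continuousOn_timeDerivWithin_Icc` : `(s, x) ↦ ∂ₜu(s, x)` is continuous on `[0, t] × 𝕋³`
  (measurability of the time integrand of the crux's residual and continuity of its slices);
* `exists_norm_timeDerivWithin_le` : `‖∂ₜu(s, x)‖ ≤ C` uniformly on `[0, t] × 𝕋³` for some `C ≥ 0`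
  (second-moment bounds uniform in the time variable).

On the interior `(0, t)` the within-derivative is the two-sided `Torus.timeDeriv`
(`Torus.timeDerivWithin_of_mem_interior`), which is how the rung consumes both facts.

Proofs. `[0, t]` has unique differentiability for `0 < t` (`uniqueDiffOn_Icc`), hence so has
`[0, t] × ℝ³`, and on it the lift of `∂ₜu` is a value of the Fréchet derivative of the lift of `u`:
`∂ₜu(s, proj y) = D(stLift u)|_{[0,t] × ℝ³}(s, y)(1, 0)` (`Torus.IsSmoothSpaceTimeOn.timeDerivWithin_apply_proj`),
which is continuous on `[0, t] × ℝ³` (`ContDiffOn.continuousOn_fderivWithin`). Continuity descends from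
`[0, t] × ℝ³` to `[0, t] × 𝕋³` because `id × proj : ℝ × ℝ³ → ℝ × 𝕋³` is an open quotient map
(the tree's `Literature.Analysis.FluidPDE.Torus.continuousOn_uncurry_of_continuousOn_stLift`, from
`Torus.isOpenQuotientMap_proj` and `IsOpenQuotientMap.prodMap`). The bound is continuity on the compact
`[0, t] × 𝕋³` (`IsCompact.exists_bound_of_continuousOn`). Folklore; nothing is cited.
-/

namespace Summit.AtomisticToContinuum.HydrodynamicLimit.Theorems.HemisphereAffineSlaving

open scoped BigOperators Topology Classical ENNReal InnerProductSpace
open Filter Set Function MeasureTheory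

noncomputable section

open Literature.MathematicalPhysics.KineticTheory (T3 V3)
open Literature.Analysis.FunctionSpaces

namespace TimeDerivBounds

/-! ## The lift of the within-time-derivative -/

variable {F : Type*} [NormedAddCommGroup F] [NormedSpace ℝ F] {t : ℝ} {u : ℝ → T3 → F}

/-- On `[0, t] × ℝ³`, `0 < t`, the directional Fréchet derivative
`z ↦ D(stLift u)|_{[0,t] × ℝ³}(z)(1, 0)` of the lift of a jointly smooth field is continuous. [folklore] -/
theorem continuousOn_fderivWithin_stLift_apply (ht : 0 < t) (hu : Torus.IsSmoothSpaceTimeOn (Icc 0 t) u) :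
    ContinuousOn (fun z : ℝ × V3 => fderivWithin ℝ (Torus.stLift u) (Icc 0 t ×ˢ univ) z ((1 : ℝ), (0 : V3)))
      (Icc 0 t ×ˢ univ) := by
  have hU : UniqueDiffOn ℝ (Icc 0 t ×ˢ (univ : Set V3)) := (uniqueDiffOn_Icc ht).prod uniqueDiffOn_univ
  exact (hu.continuousOn_fderivWithin hU (by simp)).clm_apply continuousOn_const

/-- On `[0, t] × ℝ³`, `0 < t`, the lift of `∂ₜu` is the directional Fréchet derivative of the lift of
`u` along `(1, 0)`. [folklore] -/
theorem stLift_timeDerivWithin_eqOn (ht : 0 < t) (hu : Torus.IsSmoothSpaceTimeOn (Icc 0 t) u) :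
    EqOn (Torus.stLift (Torus.timeDerivWithin (Icc 0 t) u))
      (fun z : ℝ × V3 => fderivWithin ℝ (Torus.stLift u) (Icc 0 t ×ˢ univ) z ((1 : ℝ), (0 : V3)))
      (Icc 0 t ×ˢ univ) :=
  fun p hp => hu.timeDerivWithin_apply_proj (uniqueDiffOn_Icc ht) hp.1 p.2

/-- The lift of `∂ₜu` is continuous on `[0, t] × ℝ³`. [folklore] -/
theorem continuousOn_stLift_timeDerivWithin (ht : 0 < t) (hu : Torus.IsSmoothSpaceTimeOn (Icc 0 t) u) :
    ContinuousOn (Torus.stLift (Torus.timeDerivWithin (Icc 0 t) u)) (Icc 0 t ×ˢ univ) :=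
  (continuousOn_fderivWithin_stLift_apply ht hu).congr (stLift_timeDerivWithin_eqOn ht hu)

end TimeDerivBounds

/-- Registered stub `continuousOn_timeDerivWithin_Icc` (equilibrium rung of the line
`hemisphere-affine-slaving`): the one-sided time derivative `(s, x) ↦ ∂ₜu(s, x)` of a test jointly smooth
on `[0, t] × 𝕋³`, `0 < t`, is continuous on `[0, t] × 𝕋³`. [folklore] -/
theorem continuousOn_timeDerivWithin_Icc : ∀ {F : Type} [NormedAddCommGroup F] [NormedSpace ℝ F] {t : ℝ} {u : ℝ → T3 → F}, 0 < t → Literature.Analysis.FunctionSpaces.Torus.IsSmoothSpaceTimeOn (Icc 0 t) u → ContinuousOn (fun p : ℝ × T3 => Literature.Analysis.FunctionSpaces.Torus.timeDerivWithin (Icc 0 t) u p.1 p.2) (Icc 0 t ×ˢ univ) := by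
  intro F _ _ t u ht hu
  exact Literature.Analysis.FluidPDE.Torus.continuousOn_uncurry_of_continuousOn_stLift
    (TimeDerivBounds.continuousOn_stLift_timeDerivWithin ht hu)

/-- Registered stub `exists_norm_timeDerivWithin_le` (equilibrium rung of the line
`hemisphere-affine-slaving`): the one-sided time derivative of a test jointly smooth on `[0, t] × 𝕋³`,
`0 < t`, is uniformly bounded there (continuity on a compact set). [folklore] -/
theorem exists_norm_timeDerivWithin_le : ∀ {F : Type} [NormedAddCommGroup F] [NormedSpace ℝ F] {t : ℝ} {u : ℝ → T3 → F}, 0 < t → Literature.Analysis.FunctionSpaces.Torus.IsSmoothSpaceTimeOn (Icc 0 t) u → ∃ C : ℝ, 0 ≤ C ∧ ∀ s ∈ Icc 0 t, ∀ x : T3, ‖Literature.Analysis.FunctionSpaces.Torus.timeDerivWithin (Icc 0 t) u s x‖ ≤ C := by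
  intro F _ _ t u ht hu
  obtain ⟨C, hC⟩ := (isCompact_Icc.prod isCompact_univ).exists_bound_of_continuousOn
    (continuousOn_timeDerivWithin_Icc ht hu)
  refine ⟨max C 0, le_max_right _ _, fun s hs x => ?_⟩
  exact (hC (s, x) (mk_mem_prod hs (mem_univ x))).trans (le_max_left _ _)

end

end Summit.AtomisticToContinuum.HydrodynamicLimit.Theorems.HemisphereAffineSlaving
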